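import Summits.HodgeConjecture.CorCM.Census.CyclicCharacterEvenNonrootCertificate

/-!
# Cyclic characters, XL: THE `d = 0` LAW FOR `k = 2` — `μ(G, c) = φ₂(G, c) = β(G, c) − 2`; and THE COMPLETE ℤ/4 LAW

COR-CM (cell `pub-hodgecm2`), count-neutral kernel combinatorics by the binder seat b09 (gen 44; lane CYCLIC-CHARACTER FIBRE LAW, part XL), on part XXXIX
(the lower-ruled certificate), part XVI (`isLeast_card_gfaces_generate_of_shift`), part XIX (`fib_mem_of_rel`, `zeta_mem_of_zeta_mem`, `shift_mem_of_zeta_mem`),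
gen 41ʼs fibre law (`fibreTwo_add_two_eq_card_block`) and gen 43ʼs `d = 1` laws (`isLeast_card_gfaces_generate_of_roots`) BY NAME.  Theorems only (no definition,
no `decide` beyond numerals of `ℤ/4`, no certificate, no named fact, no `sorry`).  HONEST FRAMING: `HC_CM` is NOT proved, here or anywhere in the tree; nothing
here is a period or a headline — these are census laws for the face relations of CM types.

* **THE `d = 0` LAW** (`isLeast_card_gfaces_generate_of_two_even_nonroot`, `…_card_block`).  `G` finite, `c` a central involution, `w : G ↠ ℤ/4` additive with
  `w c ≠ 0`, kernel of even size `2m ≥ 4`, and some `g` with `w g` odd NOT a root of `c` (`c ∉ ⟨g⟩`; `d₂(G/𝒦) = 0`).  Then the least number of rank-four face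
  relations whose base changes generate, with the pairs, the integer Hodge lattice is **`μ(G, c) = φ₂(G, c) = β(G, c) − 2`** — the case gen 43 left open
  (`EVEN-KERNEL-ROADMAP.md`: `φ₂ ≤ μ ≤ φ₂ + 1` was known).  Rows (numerics `HOME/pub-hodgecm2-b09/lean-g44/py/lowrule.py`): `ℤ/4 × ℤ/4` (`c = (2,0)`) 18,
  `ℤ/4 ⋊ ℤ/4` (`c = x²y²`) 19, `Q₈ ×_ε ℤ/4` 19, `ℤ/4 × ℤ/2²` (`c = (2,1,0)`) 22, `ℤ/4 × ℤ/6` (`c = (2,3)`) 178, `Dic₃ × ℤ/2` (`c = (y²,1)`) 180.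
* **THE COMPLETE ℤ/4 LAW** (`isLeast_card_gfaces_generate_of_four`): for EVERY finite `G`, central involution `c` and additive `w : G ↠ ℤ/4` with `w c ≠ 0` and
  `|ker w| ≥ 3`: **`μ(G, c) = φ₂(G, c)`**, with `φ₂ = β − 1` or `β − 2` according as every `w`-odd element is a root of `c` or not (gen 42: odd kernel; gen 43:
  even kernel, `d = 1`; this part: even kernel, `d = 0`; an odd kernel forces `d = 1`).  (`|ker w| ≤ 2`: `G` abelian of order `≤ 8`, gen 37.)
PROOF of the `d = 0` law: part XXXIXʼs certificate `S₀` (`|S₀| ≤ β − 2 = φ₂`) has the toward property, `ζ` and `R(B')`; kernel translation gives every `ζ_s`,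
hence the fibre-sum relation (part XIX) and the top arc shifts; part XVIʼs exact META closes.

## References
* [Pohlmann1968] H. Pohlmann, Algebraic cycles on abelian varieties of complex multiplication type, Ann. of Math. 88 (1968), Thm 1.
* [Milne1999] J. S. Milne, Lefschetz motives and the Tate conjecture, Compositio Math. 117 (1999), Prop. 2.1, p. 54.
-/

namespace Summit.HodgeConjecture.CorCM.Census.CyclicCharacter

open Finset
open Summit.HodgeConjecture.CorCM.Prior.AllgGroup.RfwfAllgGroup
open Summit.HodgeConjecture.CorCM.Census.BlockParity
open Summit.HodgeConjecture.CorCM.Census.Coinvariant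
open Summit.HodgeConjecture.CorCM.Census.TwistGeneration
open Summit.HodgeConjecture.CorCM.Census.BaseBlock

noncomputable section

variable {G : Type*} [Group G] [Fintype G] [DecidableEq G] {k : ℕ} {w : G → ZMod (2 ^ k)} {c : G}

/-! ## §1 The `d = 0` law for `k = 2` -/

/-- **THE `d = 0` LAW (`k = 2`): `μ(G, c) = φ₂(G, c)` and `φ₂(G, c) + 2 = β(G, c)`** — see the file header. [folklore] -/
theorem isLeast_card_gfaces_generate_of_two_even_nonroot [Fintype (CMF G c)] (hw : ∀ P Q : G, w (P * Q) = w P + w Q) (hk : 1 ≤ k) (hk2 : k = 2)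
    (hc2 : c * c = 1) (hcen : ∀ x : G, x * c = c * x) (hwc : w c ≠ 0) (h1 : ∃ g₁ : G, w g₁ = 1)
    (hnon : ∃ g : G, ¬ 2 ∣ (w g).val ∧ c ∉ Subgroup.zpowers g)
    {m : ℕ} (hm : 2 * m = (univ.filter fun s : G => w s = 0).card) (hm2 : 2 ≤ m) :
    IsLeast {n : ℕ | ∃ S : Finset (CMF G c →₀ ℤ), (↑S ⊆ gfaceSet G c hc2) ∧ S.card = n ∧
      hodgeSpan c hc2 ≤ Submodule.span ℤ (pairSet c) ⊔ Submodule.span ℤ (translates c S)} (fibreTwo c hc2) ∧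
    fibreTwo c hc2 + 2 = Fintype.card (Block c) := by
  have hk' : 2 ≤ k := by omega
  have hβ := fibreTwo_add_two_eq_card_block hw hk' h1 hc2 hcen hwc hnon
  refine ⟨?_, hβ⟩
  obtain ⟨S₀, hS₀f, hcard, htw, ⟨t, ht0, hζt⟩, ⟨B', hB'F, hR⟩⟩ := exists_nonrootCert hw hk hk2 hc2 hcen hwc h1 hnon hm hm2
  have hcov := fun Φ => hcov_of_toward c (arcType hw hk hc2 hwc 0) hc2 S₀ htw Φ
  have hζ : ∀ s : G, w s = 0 →
      (Finsupp.single (oflipCM c hc2 s (arcType hw hk hc2 hwc 0)) (1 : ℤ) - Finsupp.single (arcType hw hk hc2 hwc 0) 1) +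
        (Finsupp.single (oflipCM c hc2 s (arcType hw hk hc2 hwc 1)) (1 : ℤ) - Finsupp.single (arcType hw hk hc2 hwc 1) 1) ∈
          Submodule.span ℤ (pairSet c) ⊔ Submodule.span ℤ (translates c S₀) :=
    fun s hs => zeta_mem_of_zeta_mem hw hk hc2 hcen hwc S₀ ht0 hs hζt
  have hfib := fib_mem_of_rel hw hk hc2 hwc _ hB'F hR fun s hs => hζ s (mem_filter.mp (mem_sdiff.mp hs).1).2
  have hshift : ∀ s ∈ ((arcType hw hk hc2 hwc 0)).1,
      Finsupp.single (oflipCM c hc2 s (arcType hw hk hc2 hwc 0)) (1 : ℤ) - Finsupp.single (arcType hw hk hc2 hwc 0) 1 -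
        Finsupp.single (oflipCM c hc2 s (arcType hw hk hc2 hwc (w s))) 1 + Finsupp.single (arcType hw hk hc2 hwc (w s)) 1 ∈
          Submodule.span ℤ (pairSet c) ⊔ Submodule.span ℤ (translates c S₀) := by
    intro s hs
    rcases apply_eq_zero_or_eq_top_of_two hw hk hk2 hc2 hwc hs with h | h
    · rw [shift_eq_zero_of_apply_eq_zero hw hk hc2 hwc h]; exact Submodule.zero_mem _
    · have h' : w s = 1 := by rw [h]; subst hk2; decide
      exact shift_mem_of_zeta_mem hw hk hk2 hc2 hcen hwc S₀ ht0 h' hζt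
  have hcardφ : S₀.card ≤ fibreTwo c hc2 := by omega
  exact (isLeast_card_gfaces_generate_of_shift hw hk hc2 hcen hwc h1 S₀ hS₀f hcardφ hcov hshift hfib).2

/-- **THE `d = 0` LAW (`k = 2`), block form: `μ(G, c) = β(G, c) − 2`.** [folklore] -/
theorem isLeast_card_gfaces_generate_of_two_even_nonroot_card_block [Fintype (CMF G c)] (hw : ∀ P Q : G, w (P * Q) = w P + w Q) (hk : 1 ≤ k)
    (hk2 : k = 2) (hc2 : c * c = 1) (hcen : ∀ x : G, x * c = c * x) (hwc : w c ≠ 0) (h1 : ∃ g₁ : G, w g₁ = 1)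
    (hnon : ∃ g : G, ¬ 2 ∣ (w g).val ∧ c ∉ Subgroup.zpowers g)
    {m : ℕ} (hm : 2 * m = (univ.filter fun s : G => w s = 0).card) (hm2 : 2 ≤ m) :
    IsLeast {n : ℕ | ∃ S : Finset (CMF G c →₀ ℤ), (↑S ⊆ gfaceSet G c hc2) ∧ S.card = n ∧
      hodgeSpan c hc2 ≤ Submodule.span ℤ (pairSet c) ⊔ Submodule.span ℤ (translates c S)} (Fintype.card (Block c) - 2) := by
  obtain ⟨h, hβ⟩ := isLeast_card_gfaces_generate_of_two_even_nonroot hw hk hk2 hc2 hcen hwc h1 hnon hm hm2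
  rw [← hβ, Nat.add_sub_cancel]
  exact h

/-! ## §2 The complete ℤ/4 law -/

/-- **THE COMPLETE ℤ/4 LAW: `μ(G, c) = φ₂(G, c)`** for every finite `G`, central involution `c`, additive `w : G ↠ ℤ/4` with `w c ≠ 0` and `|ker w| ≥ 3` — no
hypothesis on the parity of the kernel or on the roots of `c`. [folklore] -/
theorem isLeast_card_gfaces_generate_of_four [Fintype (CMF G c)] (hw : ∀ P Q : G, w (P * Q) = w P + w Q) (hk : 1 ≤ k) (hk2 : k = 2)
    (hc2 : c * c = 1) (hcen : ∀ x : G, x * c = c * x) (hwc : w c ≠ 0) (h1 : ∃ g₁ : G, w g₁ = 1)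
    (h3 : 3 ≤ (univ.filter fun s : G => w s = 0).card) :
    IsLeast {n : ℕ | ∃ S : Finset (CMF G c →₀ ℤ), (↑S ⊆ gfaceSet G c hc2) ∧ S.card = n ∧
      hodgeSpan c hc2 ≤ Submodule.span ℤ (pairSet c) ⊔ Submodule.span ℤ (translates c S)} (fibreTwo c hc2) := by
  have hk' : 2 ≤ k := by omega
  by_cases hroots : ∀ g : G, ¬ 2 ∣ (w g).val → c ∈ Subgroup.zpowers g
  · exact (isLeast_card_gfaces_generate_of_roots hw hk hk' hc2 hcen hwc h1 hroots h3).1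
  · push Not at hroots
    obtain ⟨g, hg, hgc⟩ := hroots
    obtain ⟨m, hm | hm⟩ := Nat.even_or_odd' ((univ.filter fun s : G => w s = 0).card)
    · exact (isLeast_card_gfaces_generate_of_two_even_nonroot hw hk hk2 hc2 hcen hwc h1 ⟨g, hg, hgc⟩ hm.symm (by omega)).1
    · -- an odd kernel makes every `w`-odd element a root of `c`
      exfalso
      let K : Subgroup G :=
        { carrier := {g | w g = 0}
          mul_mem' := fun {a b} ha hb => by
            simp only [Set.mem_setOf_eq] at ha hb ⊢
            rw [hw, ha, hb, add_zero]
          one_mem' := map_one hw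
          inv_mem' := fun {a} ha => by
            simp only [Set.mem_setOf_eq] at ha ⊢
            rw [map_inv hw, ha, neg_zero] }
      have hKcard : Nat.card K = (univ.filter fun s : G => w s = 0).card :=
        Nat.subtype_card _ fun x => by rw [mem_filter]; exact ⟨fun h => h.2, fun h => ⟨mem_univ _, h⟩⟩
      have hodd : ∀ g : G, w g = 0 → Odd (orderOf g) := fun g hg =>
        Odd.of_dvd_nat (by rw [hKcard, hm]; exact odd_two_mul_add_one m) (Subgroup.orderOf_dvd_natCard K (show g ∈ K from hg))
      have hg0 : w g ≠ 0 := fun h => by rw [h, ZMod.val_zero] at hg; exact hg (dvd_zero 2)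
      exact hgc (c_mem_zpowers_of_apply_ne_zero hw hk hc2 hcen hwc hodd hg0)

/-- **THE COMPLETE ℤ/4 LAW, closed form**: under the same hypotheses `μ(G, c) = β(G, c) − 1` if every `w`-odd element is a root of `c`, and
`μ(G, c) = β(G, c) − 2` otherwise. [folklore] -/
theorem isLeast_card_gfaces_generate_of_four_card_block [Fintype (CMF G c)] (hw : ∀ P Q : G, w (P * Q) = w P + w Q) (hk : 1 ≤ k) (hk2 : k = 2)
    (hc2 : c * c = 1) (hcen : ∀ x : G, x * c = c * x) (hwc : w c ≠ 0) (h1 : ∃ g₁ : G, w g₁ = 1)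
    (h3 : 3 ≤ (univ.filter fun s : G => w s = 0).card) :
    IsLeast {n : ℕ | ∃ S : Finset (CMF G c →₀ ℤ), (↑S ⊆ gfaceSet G c hc2) ∧ S.card = n ∧
      hodgeSpan c hc2 ≤ Submodule.span ℤ (pairSet c) ⊔ Submodule.span ℤ (translates c S)}
      (if (∀ g : G, ¬ 2 ∣ (w g).val → c ∈ Subgroup.zpowers g) then Fintype.card (Block c) - 1 else Fintype.card (Block c) - 2) := by
  have hk' : 2 ≤ k := by omega
  have h := isLeast_card_gfaces_generate_of_four hw hk hk2 hc2 hcen hwc h1 h3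
  split_ifs with hroots
  · rw [← (isLeast_card_gfaces_generate_of_roots hw hk hk' hc2 hcen hwc h1 hroots h3).2, Nat.add_sub_cancel]; exact h
  · push Not at hroots
    obtain ⟨g, hg, hgc⟩ := hroots
    rw [← fibreTwo_add_two_eq_card_block hw hk' h1 hc2 hcen hwc ⟨g, hg, hgc⟩, Nat.add_sub_cancel]; exact h

end

end Summit.HodgeConjecture.CorCM.Census.CyclicCharacter
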